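import Literature.NumberTheory.EllipticCurves.QuarticTwistLSeriesCoefficients
import Literature.NumberTheory.QuadraticFields.GaussianQuarticSymbolValues
import HarnessLib

/-!
# Ireland–Rosen Ch. 18 §6, Theorem 7: `a_n(E_D) = Σ_{N𝔞 = n} χ_D(𝔞)`, `χ_D((x)) = \overline{(D/x)₄} x` (`x` primary)

Topic `Literature/NumberTheory/EllipticCurves`, namespace `Literature.NumberTheory.EllipticCurves.QuarticTwist`.
Theorems only (no definition, no named fact).  The coefficientwise form of «`L(E, s) = L(s, χ)`» for the quartic twist
`E_D : y² = x³ − Dx` (`D ∈ ℤ ∖ 0` free of fourth powers): for every `n ≥ 1`,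

  **`a_n(E_D) = Σ_{x ∈ ℤ[i] primary, N(x) = n} \overline{(D/x)₄} · x`**   (`lFunction_eq_sum_primaryNormEq`),

read in `ℤ[i] = GaussianInt`, with `(D/x)₄ = quarticSymbolInt D x` the composite quartic symbol of
`QuadraticFields/GaussianQuarticSymbol` (a function of the ideal `(x)`; it vanishes when `x` shares a prime with `D`, which is
Ireland–Rosen's «`χ(P) = 0` if `P ∣ 2D`» — even `n` carry no primary `x`).  Proof as printed (Ch. 18 §6, PDF p. 304): both
sides are multiplicative in `n` (Mathlib's `isMultiplicative_LFunction`; unique factorisation into primary elements,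
`sum_primaryNormEq_mul_of_coprime`) and agree on prime powers by the Euler-factor computations of
`QuarticTwistLSeriesCoefficients` (`a_p = 0`, `χ((p)) = -p` at inert `p`; `a_p = ūπ + uπ̄`, `u = (D/π)₄`, at split `p`; `0` at
`p ∣ 2D`).

* §1 `sum_primaryNormEq_mul_of_coprime` — `Σ_{x primary, Nx = mm'} f(x) = Σ_{y, z} f(yz)` for coprime `m, m'` (Ch. 9 §7 Lemma 8:
  unique factorisation into primary elements; the bijection of the tree's `primarySum_mul_of_coprime`, for an arbitrary weight);
* §2 `quarticSymbolInt_eq_zero_of_prime_dvd`, `quarticSymbolInt_star_of_norm_eq` (`(D/π̄)₄ = \overline{(D/π)₄}`,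
  «we have used `\overline{(D/π̄)₄} = (D/π)₄`»);
* §3 the twisted primary sums `Σ_{x primary, Nx = p^k} \overline{(D/x)₄} x` at prime powers;
* §4 the theorem.

## References
* K. Ireland, M. Rosen, *A Classical Introduction to Modern Number Theory*, 2nd ed., GTM 84 (1990), Ch. 18 §6, Theorem 7 and
  its proof (PDF pp. 303–304); Ch. 9 §7 Lemma 8. [IrelandRosen1990]

## Mathlib / tree search
Tree: `QuarticTwist.lFunction_apply_prime_pow_of_dvd/_of_mod_four_eq_three/_split` (`QuarticTwistLSeriesCoefficients`);
`quarticSymbolInt_mul/_pow/_isUnit_mul/_one/_spec_of_norm_eq/_eq_of_dvd/_neg_natCast_of_mod_four_eq_three`, `map_quarticSymbolInt`,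
`Φ₄`, `isPrimitiveRoot_ζ₄` (`GaussianQuarticSymbol[Values]`); `GaussianPrimary.{primaryNormEq, mem_primaryNormEq, primaryNormEq_one,
primaryNormEq_eq_empty_of_even, primaryNormEq_pow_of_mod_four_eq_three, primaryNormEq_pow_of_mod_four_eq_one, injOn_pow_mul_pow,
exists_isPrimary_norm_eq, isCoprime_natCast, self_dvd_norm, norm_dvd_norm, eq_of_dvd_of_mul_eq, …}`; `quarticSymbol_span_of_span_eq`,
`quarticResidueSymbol_zero`.  Mathlib: `Nat.recOnPosPrimePosCoprime`, `Finset.sum_bij`, `Finset.sum_image`,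
`GaussianInt.prime_iff_mod_four_eq_three_of_nat_prime`.  The `D = n²` case is `lFunction_congruentNumberCurve_eq_jacobiSym_mul_primarySum`.
-/

noncomputable section

open scoped Classical

namespace Literature.NumberTheory.EllipticCurves

namespace QuarticTwist

open WeierstrassCurve IsDedekindDomain NumberField
open Literature.NumberTheory.QuadraticFields.GaussianPrimary Literature.NumberTheory.QuadraticFields.GaussianQuarticSymbol
open Literature.NumberTheory.GaloisRepresentations

variable {D : ℤ}

/-! ### §1 Unique factorisation into primary elements: weighted sums over `N(x) = m m'` -/

/-- **Weighted multiplicativity of sums over primary elements** (Ireland–Rosen Ch. 9 §7 Lemma 8, unique factorisation into primary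
elements): for coprime `m, m'`, `(y, z) ↦ yz` is a bijection from pairs of primary elements of norms `m`, `m'` onto the primary elements
of norm `mm'`, so `Σ_{N x = mm'} f(x) = Σ_{N y = m, N z = m'} f(yz)` for every weight `f` (the tree's `primarySum_mul_of_coprime` is `f = id`).
[cite: IrelandRosen1990, Ch. 9 §7 Lemma 8; Ch. 18 §6, proof of Theorem 7 («`∏_P (1 - χ(P)NP^{-s})^{-1} = Σ_A χ(A)NA^{-s}`»)] -/
theorem sum_primaryNormEq_mul_of_coprime {M : Type*} [AddCommMonoid M] (f : GaussianInt → M) {m m' : ℕ}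
    (h : m.Coprime m') :
    ∑ x ∈ primaryNormEq (m * m'), f x = ∑ p ∈ primaryNormEq m ×ˢ primaryNormEq m', f (p.1 * p.2) := by
  symm
  have hcop : IsCoprime (m : GaussianInt) (m' : GaussianInt) := isCoprime_natCast h
  have hdvd : ∀ {y : GaussianInt} {k : ℕ}, y.norm = k → y ∣ (k : GaussianInt) := fun {y k} hy ↦ by
    have := self_dvd_norm y
    rwa [hy, Int.cast_natCast] at this
  refine Finset.sum_bij (fun p _ ↦ p.1 * p.2) ?_ ?_ ?_ (fun _ _ ↦ rfl)
  · rintro ⟨y, z⟩ hp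
    rw [Finset.mem_product] at hp
    obtain ⟨hy, hyp⟩ := mem_primaryNormEq.mp hp.1
    obtain ⟨hz, hzp⟩ := mem_primaryNormEq.mp hp.2
    refine mem_primaryNormEq.mpr ⟨?_, hyp.mul hzp⟩
    rw [Zsqrtd.norm_mul, hy, hz, Nat.cast_mul]
  · rintro ⟨y, z⟩ hp ⟨y', z'⟩ hp' hyz
    simp only at hyz
    rw [Finset.mem_product] at hp hp'
    obtain ⟨hy, hyp⟩ := mem_primaryNormEq.mp hp.1
    obtain ⟨hz, hzp⟩ := mem_primaryNormEq.mp hp.2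
    obtain ⟨hy', hyp'⟩ := mem_primaryNormEq.mp hp'.1
    obtain ⟨hz', hzp'⟩ := mem_primaryNormEq.mp hp'.2
    have hc : IsCoprime y z' :=
      (hcop.of_isCoprime_of_dvd_left (hdvd hy)).of_isCoprime_of_dvd_right (hdvd hz')
    have h1 : y ∣ y' := hc.dvd_of_dvd_mul_right ⟨z, by rw [← hyz, mul_comm]⟩
    obtain ⟨w, hw⟩ := h1
    have hm0 : (m : ℤ) ≠ 0 := by
      rw [← hy]; exact (GaussianInt.norm_pos.mpr hyp.ne_zero).ne'
    have hwn : w.norm = 1 := by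
      have := congrArg Zsqrtd.norm hw
      rw [Zsqrtd.norm_mul, hy, hy'] at this
      exact (mul_right_inj' hm0).mp (by rw [← this, mul_one])
    have hwu : IsUnit w := (Zsqrtd.norm_eq_one_iff' (by norm_num) w).mp hwn
    have hyy' : y = y' := hyp.eq_of_associated hyp' ⟨hwu.unit, by rw [IsUnit.unit_spec, hw]⟩
    subst hyy'
    have hzz' : z = z' := mul_left_cancel₀ hyp.ne_zero hyz
    subst hzz'
    rfl
  · intro x hx
    obtain ⟨hxn, hxp⟩ := mem_primaryNormEq.mp hx
    have hm0 : m ≠ 0 := by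
      rintro rfl
      rw [zero_mul, Nat.cast_zero, GaussianInt.norm_eq_zero] at hxn
      exact hxp.ne_zero hxn
    have hm0' : m' ≠ 0 := by
      rintro rfl
      rw [mul_zero, Nat.cast_zero, GaussianInt.norm_eq_zero] at hxn
      exact hxp.ne_zero hxn
    set g := EuclideanDomain.gcd x (m : GaussianInt) with hg
    set g' := EuclideanDomain.gcd x (m' : GaussianInt) with hg'
    have hgx : g ∣ x := EuclideanDomain.gcd_dvd_left _ _
    have hgm : g ∣ (m : GaussianInt) := EuclideanDomain.gcd_dvd_right _ _
    have hg'x : g' ∣ x := EuclideanDomain.gcd_dvd_left _ _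
    have hg'm : g' ∣ (m' : GaussianInt) := EuclideanDomain.gcd_dvd_right _ _
    have hcg : IsCoprime g g' := (hcop.of_isCoprime_of_dvd_left hgm).of_isCoprime_of_dvd_right hg'm
    have h1 : g * g' ∣ x := hcg.mul_dvd hgx hg'x
    have hxmm : x ∣ (m : GaussianInt) * m' := by
      have := hdvd hxn
      rwa [Nat.cast_mul] at this
    have h2 : x ∣ g * g' := by
      rw [hg, hg', EuclideanDomain.gcd_eq_gcd_ab x (m : GaussianInt), EuclideanDomain.gcd_eq_gcd_ab x (m' : GaussianInt)]
      set a := EuclideanDomain.gcdA x (m : GaussianInt)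
      set b := EuclideanDomain.gcdB x (m : GaussianInt)
      set a' := EuclideanDomain.gcdA x (m' : GaussianInt)
      set b' := EuclideanDomain.gcdB x (m' : GaussianInt)
      have : (x * a + (m : GaussianInt) * b) * (x * a' + (m' : GaussianInt) * b') =
          x * (a * (x * a' + (m' : GaussianInt) * b') + (m : GaussianInt) * b * a') + (m : GaussianInt) * m' * (b * b') := by
        ring
      rw [this]
      exact dvd_add (dvd_mul_right _ _) (hxmm.mul_right _)
    have hassoc : Associated x (g * g') := associated_of_dvd_dvd h2 h1
    have hxodd : (x.re + x.im) % 2 = 1 := hxp.odd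
    have hgodd : (g.re + g.im) % 2 = 1 := by
      rw [parity_eq_of_associated hassoc, parity_mul] at hxodd
      rcases Int.emod_two_eq_zero_or_one (g.re + g.im) with h0 | h0
      · rw [h0] at hxodd; simp at hxodd
      · exact h0
    have hg'odd : (g'.re + g'.im) % 2 = 1 := by
      rw [parity_eq_of_associated hassoc, parity_mul] at hxodd
      rcases Int.emod_two_eq_zero_or_one (g'.re + g'.im) with h0 | h0
      · rw [h0] at hxodd; simp at hxodd
      · exact h0
    have hng : g.norm.natAbs ∣ m := by
      have h3 : g.norm.natAbs ∣ m * m := by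
        have := norm_dvd_norm hgm
        rw [Zsqrtd.norm_natCast] at this
        exact Int.natAbs_dvd_natAbs.mpr this |>.trans (by simp [Int.natAbs_mul])
      have h4 : g.norm.natAbs ∣ m * m' := by
        have := norm_dvd_norm hgx
        rw [hxn] at this
        have := Int.natAbs_dvd_natAbs.mpr this
        rwa [Int.natAbs_natCast] at this
      have h5 := Nat.dvd_gcd h3 h4
      rwa [Nat.gcd_mul_left, h.gcd_eq_one, mul_one] at h5
    have hng' : g'.norm.natAbs ∣ m' := by
      have h3 : g'.norm.natAbs ∣ m' * m' := by
        have := norm_dvd_norm hg'm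
        rw [Zsqrtd.norm_natCast] at this
        exact Int.natAbs_dvd_natAbs.mpr this |>.trans (by simp [Int.natAbs_mul])
      have h4 : g'.norm.natAbs ∣ m * m' := by
        have := norm_dvd_norm hg'x
        rw [hxn] at this
        have := Int.natAbs_dvd_natAbs.mpr this
        rwa [Int.natAbs_natCast] at this
      have h5 := Nat.dvd_gcd h4 h3
      rwa [Nat.gcd_mul_right, h.gcd_eq_one, one_mul] at h5
    have hN : g.norm.natAbs * g'.norm.natAbs = m * m' := by
      obtain ⟨u, hu⟩ := hassoc
      have := congrArg Zsqrtd.norm hu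
      rw [Zsqrtd.norm_mul, Zsqrtd.norm_mul, (Zsqrtd.norm_eq_one_iff' (by norm_num) _).mpr u.isUnit,
        mul_one, hxn] at this
      have := congrArg Int.natAbs this
      rwa [Int.natAbs_mul, Int.natAbs_natCast, eq_comm] at this
    obtain ⟨hgm_eq, hg'm_eq⟩ := eq_of_dvd_of_mul_eq hng hng' hN hm0 hm0'
    refine ⟨(primary g, primary g'), ?_, ?_⟩
    · rw [Finset.mem_product]
      refine ⟨mem_primaryNormEq.mpr ⟨?_, isPrimary_primary hgodd⟩,
        mem_primaryNormEq.mpr ⟨?_, isPrimary_primary hg'odd⟩⟩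
      · rw [norm_primary hgodd, ← hgm_eq, Int.natAbs_of_nonneg (GaussianInt.norm_nonneg g)]
      · rw [norm_primary hg'odd, ← hg'm_eq, Int.natAbs_of_nonneg (GaussianInt.norm_nonneg g')]
    · simp only
      rw [← primary_mul, ← primary_eq_primary_of_associated hassoc, primary_of_isPrimary hxp]

/-! ### §2 Two more values of `(D/x)₄` -/

/-- `(D/π)₄ = 0` for a prime `π ∣ D` («If `π ∣ α` then `χ_π(α) = 0`»; at `π ∣ 2` the tree's junk value is `0` as well).
[cite: IrelandRosen1990, Ch. 9 §8, Definition after Prop. 9.8.2; Ch. 18 §6 («If `P` divides `2D` define `χ(P) = 0`»)] -/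
theorem quarticSymbolInt_eq_zero_of_prime_dvd {π : GaussianInt} (hπ : Prime π) (hπD : π ∣ (D : GaussianInt)) :
    quarticSymbolInt D π = 0 := by
  have hπK : Prime (Φ₄ π) := (MulEquiv.prime_iff (Φ₄ : GaussianInt ≃* 𝓞 K₄)).mpr hπ
  let 𝔭 : HeightOneSpectrum (𝓞 K₄) :=
    ⟨Ideal.span {Φ₄ π}, (Ideal.span_singleton_prime hπK.ne_zero).mpr hπK,
      by rw [Ne, Ideal.span_singleton_eq_bot]; exact hπK.ne_zero⟩
  apply Φ₄.injective
  rw [map_quarticSymbolInt, map_zero, quarticSymbol_span_of_span_eq (show 𝔭.asIdeal = Ideal.span {Φ₄ π} from rfl),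
    show Ideal.Quotient.mk 𝔭.asIdeal (D : 𝓞 K₄) = 0 from ?_, quarticResidueSymbol_zero isPrimitiveRoot_ζ₄]
  rw [Ideal.Quotient.eq_zero_iff_mem, show 𝔭.asIdeal = Ideal.span {Φ₄ π} from rfl, Ideal.mem_span_singleton,
    show (D : 𝓞 K₄) = Φ₄ (D : GaussianInt) from (map_intCast Φ₄ D).symm, map_dvd_iff]
  exact hπD

/-- **`(D/π̄)₄ = \overline{(D/π)₄}`** at a split prime `π`, `N(π) = p ≡ 1 (4)`, `p ∤ D` («We have used `\overline{(D/π̄)₄} = (D/π)₄`»: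
conjugate Euler's criterion `π ∣ D^{(p-1)/4} − u` and use uniqueness at `π̄`). [cite: IrelandRosen1990, Ch. 18 §6, proof of Theorem 7 (PDF p. 304)] -/
theorem quarticSymbolInt_star_of_norm_eq {p : ℕ} (hp : p.Prime) (hp1 : p % 4 = 1) {π : GaussianInt} (hπ : π.norm = p)
    (hpD : ¬ (p : ℤ) ∣ D) : quarticSymbolInt D (star π) = star (quarticSymbolInt D π) := by
  obtain ⟨h4, hdvd⟩ := quarticSymbolInt_spec_of_norm_eq hp hp1 hπ hpD
  refine quarticSymbolInt_eq_of_dvd hp hp1 (by rw [Zsqrtd.norm_conj, hπ]) hpD (by rw [← star_pow, h4, star_one]) ?_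
  obtain ⟨c, hc⟩ := hdvd
  refine ⟨star c, ?_⟩
  have hD' : star (D : GaussianInt) = (D : GaussianInt) := by ext <;> simp
  rw [← star_mul', ← hc, star_sub, star_pow, hD']

/-! ### §3 The twisted primary sums at prime powers -/

/-- `Σ_{N x = 1} \overline{(D/x)₄} x = 1`. [cite: IrelandRosen1990, Ch. 18 §6, proof of Theorem 7] -/
theorem sum_primaryNormEq_one (D : ℤ) :
    ∑ x ∈ primaryNormEq 1, star (quarticSymbolInt D x) * x = 1 := by
  rw [primaryNormEq_one, Finset.sum_singleton, quarticSymbolInt_one, star_one, one_mul]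

/-- No primary element has even norm: the sums over `N x = p^{k+1}` vanish for `p = 2`. [cite: IrelandRosen1990, Ch. 9 §7 (primary elements are odd)] -/
theorem sum_primaryNormEq_two_pow (D : ℤ) (k : ℕ) :
    ∑ x ∈ primaryNormEq (2 ^ (k + 1)), star (quarticSymbolInt D x) * x = 0 := by
  rw [primaryNormEq_eq_empty_of_even (dvd_pow_self 2 (Nat.succ_ne_zero k)), Finset.sum_empty]

/-- **Inert prime powers**: for `p ≡ 3 (4)`, `p ∤ D`: `Σ_{N x = p^{2j}} \overline{(D/x)₄} x = (-p)^j` (the only primary `x` is `(-p)^j`,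
`(D/(-p))₄ = 1`) and the sum over `N x = p^{2j+1}` is empty. [cite: IrelandRosen1990, Ch. 18 §6, Lemma and proof of Theorem 7 (PDF p. 304)] -/
theorem sum_primaryNormEq_pow_of_mod_four_eq_three {p : ℕ} (hp : p.Prime) (hp3 : p % 4 = 3) (hpD : ¬ (p : ℤ) ∣ D) (j : ℕ) :
    ∑ x ∈ primaryNormEq (p ^ (2 * j)), star (quarticSymbolInt D x) * x = (-(p : GaussianInt)) ^ j ∧
      ∑ x ∈ primaryNormEq (p ^ (2 * j + 1)), star (quarticSymbolInt D x) * x = 0 := by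
  haveI := Fact.mk hp
  obtain ⟨h1, h2⟩ := primaryNormEq_pow_of_mod_four_eq_three (p := p) hp3 j
  refine ⟨?_, by rw [h2, Finset.sum_empty]⟩
  have hp0 : (-(p : GaussianInt)) ≠ 0 := neg_ne_zero.mpr (by exact_mod_cast hp.ne_zero)
  rw [h1, Finset.sum_singleton, quarticSymbolInt_pow D hp0, quarticSymbolInt_neg_natCast_of_mod_four_eq_three hp hp3 hpD,
    one_pow, star_one, one_mul]

/-- Inert prime powers at a bad inert prime `p ∣ D`: all twisted sums over `N x = p^{k+1}` vanish (`(D/p)₄ = 0`).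
[cite: IrelandRosen1990, Ch. 18 §6 («If `P` divides `2D` define `χ(P) = 0`»)] -/
theorem sum_primaryNormEq_pow_of_mod_four_eq_three_of_dvd {p : ℕ} (hp : p.Prime) (hp3 : p % 4 = 3) (hpD : (p : ℤ) ∣ D)
    (k : ℕ) : ∑ x ∈ primaryNormEq (p ^ (k + 1)), star (quarticSymbolInt D x) * x = 0 := by
  haveI := Fact.mk hp
  have hpp : Prime (p : GaussianInt) := (GaussianInt.prime_iff_mod_four_eq_three_of_nat_prime p).mpr hp3
  have hpD' : (p : GaussianInt) ∣ (D : GaussianInt) := by simpa using map_dvd (Int.castRingHom GaussianInt) hpD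
  have h0 : quarticSymbolInt D (-(p : GaussianInt)) = 0 := by
    rw [show (-(p : GaussianInt)) = -1 * p by ring, quarticSymbolInt_isUnit_mul D isUnit_one.neg,
      quarticSymbolInt_eq_zero_of_prime_dvd hpp hpD']
  obtain ⟨j, hk | hk⟩ := Nat.even_or_odd' (k + 1)
  · obtain ⟨h1, -⟩ := primaryNormEq_pow_of_mod_four_eq_three (p := p) hp3 j
    have hj : 1 ≤ j := by omega
    rw [hk, h1, Finset.sum_singleton, quarticSymbolInt_pow D (neg_ne_zero.mpr (by exact_mod_cast hp.ne_zero)), h0,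
      zero_pow (by omega), star_zero, zero_mul]
  · obtain ⟨-, h2⟩ := primaryNormEq_pow_of_mod_four_eq_three (p := p) hp3 j
    rw [hk, h2, Finset.sum_empty]

/-- **Split prime powers**: `p ≡ 1 (4)`, `p ∤ D`, `π` primary of norm `p`, `u = (D/π)₄`:
`Σ_{N x = p^k} \overline{(D/x)₄} x = Σ_{j ≤ k} (ūπ)^j (uπ̄)^{k-j}` (the primary `x` are the `π^j π̄^{k-j}` and `(D/π̄)₄ = ū`).
[cite: IrelandRosen1990, Ch. 18 §6, proof of Theorem 7, case p ≡ 1 (4) (PDF p. 304)] -/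
theorem sum_primaryNormEq_pow_of_mod_four_eq_one {p : ℕ} (hp : p.Prime) (hp1 : p % 4 = 1) (hpD : ¬ (p : ℤ) ∣ D)
    {π : GaussianInt} (hπ : IsPrimary π) (hπp : π.norm = p) (k : ℕ) :
    ∑ x ∈ primaryNormEq (p ^ k), star (quarticSymbolInt D x) * x =
      ∑ j ∈ Finset.range (k + 1), (star (quarticSymbolInt D π) * π) ^ j * (quarticSymbolInt D π * star π) ^ (k - j) := by
  have hπ0 : π ≠ 0 := hπ.ne_zero
  have hσ0 : star π ≠ 0 := hπ.star.ne_zero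
  rw [primaryNormEq_pow_of_mod_four_eq_one hp hπ hπp k, Finset.sum_image (injOn_pow_mul_pow hp hp1 hπp k)]
  refine Finset.sum_congr rfl fun j _ ↦ ?_
  rw [quarticSymbolInt_mul D (pow_ne_zero _ hπ0) (pow_ne_zero _ hσ0), quarticSymbolInt_pow D hπ0, quarticSymbolInt_pow D hσ0,
    quarticSymbolInt_star_of_norm_eq hp hp1 hπp hpD, star_mul, star_pow, star_pow, star_star]
  ring

/-- Split prime powers at a bad split prime `p ∣ D`: the twisted sums over `N x = p^{k+1}` vanish (`(D/π)₄ = (D/π̄)₄ = 0`).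
[cite: IrelandRosen1990, Ch. 18 §6 («If `P` divides `2D` define `χ(P) = 0`»)] -/
theorem sum_primaryNormEq_pow_of_mod_four_eq_one_of_dvd {p : ℕ} (hp : p.Prime) (hpD : (p : ℤ) ∣ D)
    {π : GaussianInt} (hπ : IsPrimary π) (hπp : π.norm = p) (k : ℕ) :
    ∑ x ∈ primaryNormEq (p ^ (k + 1)), star (quarticSymbolInt D x) * x = 0 := by
  have hπ0 : π ≠ 0 := hπ.ne_zero
  have hσ0 : star π ≠ 0 := hπ.star.ne_zero
  have hprime := prime_of_norm_eq_prime hp hπp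
  have hp_eq : (p : GaussianInt) = π * star π := natCast_eq_mul_star hπp
  have hpD' : (p : GaussianInt) ∣ (D : GaussianInt) := by simpa using map_dvd (Int.castRingHom GaussianInt) hpD
  have hu : quarticSymbolInt D π = 0 :=
    quarticSymbolInt_eq_zero_of_prime_dvd hprime ((Dvd.intro _ hp_eq.symm).trans hpD')
  have hu' : quarticSymbolInt D (star π) = 0 :=
    quarticSymbolInt_eq_zero_of_prime_dvd (prime_of_norm_eq_prime hp (by rw [Zsqrtd.norm_conj, hπp]))
      ((Dvd.intro_left _ hp_eq.symm).trans hpD')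
  rw [primaryNormEq_pow_of_mod_four_eq_one hp hπ hπp (k + 1)]
  refine Finset.sum_eq_zero fun x hx ↦ ?_
  obtain ⟨j, hj, rfl⟩ := Finset.mem_image.mp hx
  rw [Finset.mem_range] at hj
  rw [quarticSymbolInt_mul D (pow_ne_zero _ hπ0) (pow_ne_zero _ hσ0), quarticSymbolInt_pow D hπ0, quarticSymbolInt_pow D hσ0,
    hu, hu']
  rcases Nat.eq_zero_or_pos j with rfl | hj0
  · rw [Nat.sub_zero, zero_pow (Nat.succ_ne_zero k)]; simp
  · rw [zero_pow hj0.ne']; simp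

/-! ### §4 Theorem 18.7, coefficientwise -/

/-- **Ireland–Rosen Theorem 18.7 («`L(E, s) = L(s, χ)`»), coefficient by coefficient, on Mathlib's `L`-function of
`E_D : y² = x³ − Dx`** (`D ≠ 0` free of fourth powers): for every `n ≥ 1`,
`a_n(E_D) = Σ_{x ∈ ℤ[i] primary, N(x) = n} \overline{(D/x)₄} · x` — the sum `Σ_{N𝔞 = n} χ(𝔞)` for the Hecke character
`χ((x)) = \overline{(D/x)₄} x` («`α` is the unique generator of `A` such that `α ≡ 1 (2 + 2i)`»).  Both sides are multiplicative and
agree on prime powers (§3 against `QuarticTwistLSeriesCoefficients`). [cite: IrelandRosen1990, Ch. 18 §6, Theorem 7 and its proof (PDF pp. 303–304)] -/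
theorem lFunction_eq_sum_primaryNormEq (hD : D ≠ 0) (hD4 : ∀ p : ℕ, p.Prime → ¬ (p : ℤ) ^ 4 ∣ D) {n : ℕ} (hn : n ≠ 0) :
    (((⟨0, 0, 0, -(D : ℚ), 0⟩ : WeierstrassCurve ℚ).LFunction n : ℤ) : GaussianInt) =
      ∑ x ∈ primaryNormEq n, star (quarticSymbolInt D x) * x := by
  induction n using Nat.recOnPosPrimePosCoprime with
  | zero => exact absurd rfl hn
  | one =>
    rw [(⟨0, 0, 0, -(D : ℚ), 0⟩ : WeierstrassCurve ℚ).isMultiplicative_LFunction.map_one, sum_primaryNormEq_one]; simp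
  | prime_pow p k hp hk =>
    haveI := Fact.mk hp
    obtain ⟨k', rfl⟩ : ∃ k', k = k' + 1 := ⟨k - 1, by omega⟩
    by_cases hpD2 : (p : ℤ) ∣ 2 * D
    · -- additive prime: both sides vanish
      rw [lFunction_apply_prime_pow_of_dvd hD hp hpD2 (hD4 p hp) k', Int.cast_zero]
      by_cases hp2 : p = 2
      · subst hp2
        exact (sum_primaryNormEq_two_pow D k').symm
      · have hpD : (p : ℤ) ∣ D := by
          rcases (Nat.prime_iff_prime_int.mp hp).dvd_or_dvd hpD2 with h2 | h
          · exact absurd ((Nat.prime_dvd_prime_iff_eq hp Nat.prime_two).mp (by exact_mod_cast h2)) hp2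
          · exact h
        rcases (show p % 4 = 1 ∨ p % 4 = 3 by rcases hp.eq_two_or_odd with h | h; exact absurd h hp2; omega) with h1 | h3
        · obtain ⟨π, hπ, hπp⟩ := exists_isPrimary_norm_eq (p := p) h1
          exact (sum_primaryNormEq_pow_of_mod_four_eq_one_of_dvd hp hpD hπ hπp k').symm
        · exact (sum_primaryNormEq_pow_of_mod_four_eq_three_of_dvd hp h3 hpD k').symm
    · have hpD : ¬ (p : ℤ) ∣ D := fun h ↦ hpD2 (h.mul_left 2)
      have hp2 : p ≠ 2 := fun h ↦ hpD2 (h ▸ dvd_mul_right 2 D)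
      rcases (show p % 4 = 1 ∨ p % 4 = 3 by rcases hp.eq_two_or_odd with h | h; exact absurd h hp2; omega) with h1 | h3
      · obtain ⟨π, hπ, hπp⟩ := exists_isPrimary_norm_eq (p := p) h1
        obtain ⟨h4, hdvd⟩ := quarticSymbolInt_spec_of_norm_eq hp h1 hπp hpD
        rw [lFunction_apply_prime_pow_split hp h1 hpD hπ hπp h4 hdvd (k' + 1),
          sum_primaryNormEq_pow_of_mod_four_eq_one hp h1 hpD hπ hπp (k' + 1)]
      · obtain ⟨j, hj | hj⟩ := Nat.even_or_odd' (k' + 1)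
        · rw [hj, (lFunction_apply_prime_pow_of_mod_four_eq_three hp h3 hpD j).1,
            (sum_primaryNormEq_pow_of_mod_four_eq_three hp h3 hpD j).1]
          push_cast; ring
        · rw [hj, (lFunction_apply_prime_pow_of_mod_four_eq_three hp h3 hpD j).2,
            (sum_primaryNormEq_pow_of_mod_four_eq_three hp h3 hpD j).2, Int.cast_zero]
  | coprime a b ha hb hab iha ihb =>
    rw [(⟨0, 0, 0, -(D : ℚ), 0⟩ : WeierstrassCurve ℚ).isMultiplicative_LFunction.map_mul_of_coprime hab, Int.cast_mul,
      iha (by omega), ihb (by omega), sum_primaryNormEq_mul_of_coprime _ hab, Finset.sum_product, Finset.sum_mul_sum]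
    refine Finset.sum_congr rfl fun y hy ↦ Finset.sum_congr rfl fun z hz ↦ ?_
    rw [quarticSymbolInt_mul D (mem_primaryNormEq.mp hy).2.ne_zero (mem_primaryNormEq.mp hz).2.ne_zero, star_mul]
    ring

end QuarticTwist

end Literature.NumberTheory.EllipticCurves

end
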